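import Summits.AtomisticToContinuum.FouriersLaw.Theorems.JunctionLocalitySuperadditiveResistanceKuboGreen
import Summits.AtomisticToContinuum.FouriersLaw.Theorems.JunctionLocalitySuperadditiveResistanceKuboDirichlet
import Summits.AtomisticToContinuum.FouriersLaw.Theorems.JunctionLocalitySuperadditiveResistancePlainAdjoint

/-!
# `CorrectorTheory` (stmt-AtomisticToContinuum-14071), part 5: the tap energy identity

Helper file for support item `stmt-AtomisticToContinuum-14071`
(`OddSectorIrreversibility.CorrectorTheory`, conjunct A (6)).

For the pinned anharmonic chain `P = pinnedChain ω₂ lam β γ` (`ω₂ > 0`, `lam, β ≥ 0`, `γ > 0`),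
`T > 0`, `ρ = e^{-H/T}`, and ANY classical solution `u ∈ C² ∩ L²(μ_T)` of the Poisson equation
`L_{T,T} u = -k` with `k ∈ L²(μ_T)` (the Kubo corrector of part 4 with `k = J`):

* `memLp_partialP_of_poisson` — finite entropy production `∂_{p_b} u ∈ L²(μ_T)` at the bath sites;
* `integral_mul_source_eq_dirichlet` — **the tap energy identity**
  `∫ u k ρ dx = γ T ∑_i ([i=0] + [i=N-1]) ∫ (∂_{p_i} u)² ρ dx` (`= -⟨L u, u⟩ = -⟨S u, u⟩`: the
  Liouville part is antisymmetric, the two Ornstein–Uhlenbeck taps are the Dirichlet form);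
* `tap_energy_identity` — the same in the vocabulary of the route decl: for `b₀ = 0`, `b₁ = N-1`,
  `γ T (∫ (∂_{p_{b₀}}u)² dμ_T + ∫ (∂_{p_{b₁}}u)² dμ_T) = ∫ u k dμ_T`, `μ_T = e^{-H/T} dq dp` the
  UNNORMALISED Gibbs weight (for `N = 1` both baths sit on site `0` and the two terms coincide,
  matching the generator's double tap).

Everything is the tree's energy-cutoff Green calculus for `X_H + γ S_B` in `L²(e^{-H/T}dx)`
(`JunctionLocalitySuperadditiveResistanceKubo*`: `polar_level`, `memLp_partialP`,
`tendsto_integral_chi_mul`, `tendsto_integral_partialP_chi_mul`) specialised to `B = bathWeight`,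
`σ = 1`, `c = γ`, `f = h = u`. References: Eckmann–Pillet–Rey-Bellet 1999 §3; Kundu–Dhar–Narayan
2009 (reln3). Nothing here closes the item.
-/

noncomputable section

open MeasureTheory Filter Topology ProbabilityTheory
open scoped ContDiff NNReal ENNReal
open Literature.MathematicalPhysics.KineticTheory.HeatConduction
open Summit.AtomisticToContinuum.FouriersLaw.Theorems.SuperadditiveResistance.DeviceLiouville
open Summit.AtomisticToContinuum.FouriersLaw.Theorems.SuperadditiveResistance.Kubo

namespace Summit.AtomisticToContinuum.FouriersLaw.Theorems.OddSectorIrreversibility.Corrector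

variable {N : ℕ}

/-- The bath multiplicities are nonnegative. [folklore] -/
theorem bathWeight_nonneg (N : ℕ) (i : Fin N) : 0 ≤ OscillatorChain.bathWeight N i := by
  unfold OscillatorChain.bathWeight
  split_ifs <;> norm_num

/-- Integrals against the unnormalised Gibbs weight `e^{-H/T} dq dp` are Lebesgue integrals with the
density factor. [folklore] -/
theorem integral_withDensity_gibbs (P : OscillatorChain) (hU : Continuous P.U) (hV : Continuous P.V)
    (N : ℕ) (T : ℝ) (f : PhaseSpace N → ℝ) :
    ∫ x, f x ∂((volume : Measure (PhaseSpace N)).withDensity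
        (fun x => ENNReal.ofReal (Real.exp (-(P.hamiltonian N x) / T)))) =
      ∫ x, f x * P.gibbsDensity N T x := by
  have hm : Measurable fun x => ENNReal.ofReal (Real.exp (-(P.hamiltonian N x) / T)) :=
    (P.continuous_gibbsDensity hU hV N T).measurable.ennreal_ofReal
  rw [integral_withDensity_eq_integral_toReal_smul hm (Eventually.of_forall fun _ => ENNReal.ofReal_lt_top)]
  refine integral_congr_ae (Eventually.of_forall fun x => ?_)
  simp only [smul_eq_mul, ENNReal.toReal_ofReal (Real.exp_pos _).le, OscillatorChain.gibbsDensity]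
  ring

section Pinned

variable {ω₂ lam β γ : ℝ} (hω : 0 < ω₂) (hl : 0 ≤ lam) (hβ : 0 ≤ β) (hγ : 0 < γ) {T : ℝ} (hT : 0 < T)
include hω hl hβ hγ hT

/-- **Finite entropy production of classical `L²` solutions of the Poisson equation**: if `u ∈ C²`,
`u, k ∈ L²(μ_T)` and `L_{T,T} u = -k` pointwise, then `∂_{p_i} u ∈ L²(μ_T)` at every bath site.
[folklore] -/
theorem memLp_partialP_of_poisson {u k : PhaseSpace N → ℝ} (hu : ContDiff ℝ 2 u)
    (hu2 : MemLp u 2 ((pinnedChain ω₂ lam β γ).gibbsMeasure N T))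
    (hk2 : MemLp k 2 ((pinnedChain ω₂ lam β γ).gibbsMeasure N T))
    (hpde : ∀ x, (pinnedChain ω₂ lam β γ).generator N T T u x = -k x) {i : Fin N}
    (hi : 0 < OscillatorChain.bathWeight N i) :
    MemLp (partialP i u) 2 ((pinnedChain ω₂ lam β γ).gibbsMeasure N T) := by
  have hpde' : ∀ x, 1 * liouvilleOp (pinnedChain ω₂ lam β γ) N u x +
      γ * bathOp N (OscillatorChain.bathWeight N) T u x = -k x := fun x => by
    rw [one_mul, ← hpde x, generator_eq_liouvilleOp_add]; rfl
  exact memLp_partialP hω hl hβ γ N hT (OscillatorChain.bathWeight N) (bathWeight_nonneg N) 1 hγ hu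
    hu2 hk2 hpde' hi

/-- **The tap energy identity (density form).** For `u ∈ C² ∩ L²(μ_T)`, a continuous
`k ∈ L²(μ_T)` with `L_{T,T} u = -k` pointwise:
`∫ u k e^{-H/T} dx = γ T ∑_i ([i=0]+[i=N-1]) ∫ (∂_{p_i} u)² e^{-H/T} dx`. Proof: the polarised
Green identity at cutoff level `n` (`polar_level` with `f = h = u`) and `n → ∞` by dominated
convergence (`χ_n → 1`, `∂χ_n → 0`), all integrands being in `L¹`. [folklore] -/
theorem integral_mul_source_eq_dirichlet {u k : PhaseSpace N → ℝ} (hu : ContDiff ℝ 2 u)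
    (hu2 : MemLp u 2 ((pinnedChain ω₂ lam β γ).gibbsMeasure N T)) (hkc : Continuous k)
    (hk2 : MemLp k 2 ((pinnedChain ω₂ lam β γ).gibbsMeasure N T))
    (hpde : ∀ x, (pinnedChain ω₂ lam β γ).generator N T T u x = -k x) :
    ∫ x, u x * k x * (pinnedChain ω₂ lam β γ).gibbsDensity N T x =
      γ * T * ∑ i : Fin N, OscillatorChain.bathWeight N i *
        ∫ x, partialP i u x ^ 2 * (pinnedChain ω₂ lam β γ).gibbsDensity N T x := by
  set P := pinnedChain ω₂ lam β γ with hP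
  set ρ := P.gibbsDensity N T with hρ
  set B := OscillatorChain.bathWeight N with hB
  have hpde' : ∀ x, 1 * liouvilleOp P N u x + γ * bathOp N B T u x = -k x := fun x => by
    rw [one_mul, ← hpde x, generator_eq_liouvilleOp_add]; rfl
  have hu1 : ContDiff ℝ 1 u := hu.of_le (by norm_cast)
  have huc : Continuous u := hu.continuous
  have hduc : ∀ i, Continuous (partialP i u) := fun i => continuous_partialP hu1 one_ne_zero i
  -- the level-`n` identity
  have hlevel : ∀ n : ℕ, ∫ x, chi P N n x * (u x * k x + u x * k x) * ρ x =
      γ * T * ∑ i, B i * (2 * (∫ x, chi P N n x * partialP i u x * partialP i u x * ρ x) +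
        ∫ x, (u x * partialP i u x + u x * partialP i u x) * partialP i (chi P N n) x * ρ x) :=
    fun n => polar_level hω hl hβ N hT B 1 γ hu hu hpde' hpde' n
  -- integrability of the limiting integrands
  have hukL1 : Integrable fun x => (u x * k x + u x * k x) * ρ x := by
    have h := integrable_mul_mul_gibbsDensity hω hl hβ γ N hT hu2 hk2
    have : (fun x => (u x * k x + u x * k x) * ρ x) = fun x => 2 * (u x * k x * ρ x) := by
      funext x; ring
    rw [this]; exact h.const_mul 2
  have hdu2 : ∀ {i : Fin N}, 0 < B i → MemLp (partialP i u) 2 (P.gibbsMeasure N T) := fun {i} hi =>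
    memLp_partialP_of_poisson hω hl hβ hγ hT hu hu2 hk2 hpde hi
  -- the left-hand side converges to `∫ (uk + uk) ρ`
  have hlimL : Tendsto (fun n : ℕ => ∫ x, chi P N n x * (u x * k x + u x * k x) * ρ x) atTop
      (𝓝 (∫ x, (u x * k x + u x * k x) * ρ x)) :=
    tendsto_integral_chi_mul hω.le hl hβ γ N T
      (((huc.mul hkc).add (huc.mul hkc)).aestronglyMeasurable) hukL1
  -- each summand of the right-hand side converges
  have hlimS : ∀ i : Fin N, Tendsto (fun n : ℕ => B i *
      (2 * (∫ x, chi P N n x * partialP i u x * partialP i u x * ρ x) +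
        ∫ x, (u x * partialP i u x + u x * partialP i u x) * partialP i (chi P N n) x * ρ x)) atTop
      (𝓝 (B i * (2 * (∫ x, partialP i u x ^ 2 * ρ x) + 0))) := by
    intro i
    rcases (bathWeight_nonneg N i).eq_or_lt with hi | hi
    · have hBi : B i = 0 := hi.symm
      simp only [hBi, zero_mul]
      exact tendsto_const_nhds
    · have hdi := hdu2 hi
      refine Tendsto.const_mul _ (Tendsto.add (Tendsto.const_mul _ ?_) ?_)
      · -- `∫ χ_n (∂u)² ρ → ∫ (∂u)² ρ`
        have hF : Integrable fun x => (partialP i u x * partialP i u x) * ρ x := by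
          have := integrable_sq_mul_gibbsDensity hω hl hβ γ N hT hdi
          refine this.congr (Eventually.of_forall fun x => ?_)
          simp only [hρ]; ring
        have h := tendsto_integral_chi_mul hω.le hl hβ γ N T ((hduc i).mul (hduc i)).aestronglyMeasurable hF
        have e1 : (fun n : ℕ => ∫ x, chi P N n x * partialP i u x * partialP i u x * ρ x) =
            fun n => ∫ x, chi P N n x * (partialP i u x * partialP i u x) * ρ x := by
          funext n; exact integral_congr_ae (Eventually.of_forall fun x => by ring)
        have e2 : ∫ x, partialP i u x ^ 2 * ρ x = ∫ x, (partialP i u x * partialP i u x) * ρ x :=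
          integral_congr_ae (Eventually.of_forall fun x => by ring)
        rw [e1, e2]
        exact h
      · -- `∫ (u ∂u + u ∂u) ∂χ_n ρ → 0`
        have hF : Integrable fun x => (u x * partialP i u x + u x * partialP i u x) * ρ x := by
          have := integrable_mul_mul_gibbsDensity hω hl hβ γ N hT hu2 hdi
          have e : (fun x => (u x * partialP i u x + u x * partialP i u x) * ρ x) =
              fun x => 2 * (u x * partialP i u x * ρ x) := by funext x; ring
          rw [e]; exact this.const_mul 2
        have h := tendsto_integral_partialP_chi_mul hω hl hβ γ N T i
          (((huc.mul (hduc i)).add (huc.mul (hduc i))).aestronglyMeasurable) hF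
        have e1 : (fun n : ℕ => ∫ x, (u x * partialP i u x + u x * partialP i u x) *
            partialP i (chi P N n) x * ρ x) = fun n => ∫ x, partialP i (chi P N n) x *
              (u x * partialP i u x + u x * partialP i u x) * ρ x := by
          funext n; exact integral_congr_ae (Eventually.of_forall fun x => by ring)
        rw [e1]
        exact h
  have hlimR : Tendsto (fun n : ℕ => γ * T * ∑ i, B i *
      (2 * (∫ x, chi P N n x * partialP i u x * partialP i u x * ρ x) +
        ∫ x, (u x * partialP i u x + u x * partialP i u x) * partialP i (chi P N n) x * ρ x)) atTop
      (𝓝 (γ * T * ∑ i, B i * (2 * (∫ x, partialP i u x ^ 2 * ρ x) + 0))) :=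
    (tendsto_finsetSum _ fun i _ => hlimS i).const_mul _
  -- compare the limits
  have heq : ∫ x, (u x * k x + u x * k x) * ρ x = γ * T * ∑ i, B i * (2 * (∫ x, partialP i u x ^ 2 * ρ x) + 0) :=
    tendsto_nhds_unique (hlimL.congr fun n => hlevel n) hlimR
  have e3 : ∫ x, (u x * k x + u x * k x) * ρ x = 2 * ∫ x, u x * k x * ρ x := by
    rw [← integral_const_mul]
    exact integral_congr_ae (Eventually.of_forall fun x => by ring)
  rw [e3] at heq
  simp only [add_zero] at heq
  have e4 : ∑ i, B i * (2 * ∫ x, partialP i u x ^ 2 * ρ x) = 2 * ∑ i, B i * ∫ x, partialP i u x ^ 2 * ρ x := by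
    rw [Finset.mul_sum]
    exact Finset.sum_congr rfl fun i _ => by ring
  rw [e4] at heq
  linarith

omit hω hl hβ hγ hT in
/-- `∑_i ([i=0]+[i=N-1]) a_i = a_{b₀} + a_{b₁}` for the two bath sites `b₀ = 0`, `b₁ = N - 1`
(equal when `N = 1`). [folklore] -/
theorem sum_bathWeight_mul (a : Fin N → ℝ) {b₀ b₁ : Fin N} (hb₀ : b₀.val = 0) (hb₁ : b₁.val = N - 1) :
    ∑ i : Fin N, OscillatorChain.bathWeight N i * a i = a b₀ + a b₁ := by
  simp only [OscillatorChain.bathWeight, add_mul, Finset.sum_add_distrib, ite_mul, one_mul, zero_mul]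
  congr 1
  · rw [Finset.sum_eq_single_of_mem b₀ (Finset.mem_univ _)]
    · rw [if_pos hb₀]
    · intro b _ hb
      rw [if_neg]
      exact fun h => hb (Fin.ext (by omega))
  · rw [Finset.sum_eq_single_of_mem b₁ (Finset.mem_univ _)]
    · rw [if_pos hb₁]
    · intro b _ hb
      rw [if_neg]
      exact fun h => hb (Fin.ext (by omega))

omit hω hl hβ hγ hT in
/-- **The tap energy identity in the vocabulary of `CorrectorTheory` (6)**: for `u ∈ C² ∩ L²(μ_T)`,
a continuous `k ∈ L²(μ_T)` with `L_{T,T} u = -k` pointwise, and the bath sites `b₀ = 0`,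
`b₁ = N - 1`: `γ T (∫ (∂_{p_{b₀}} u)² dμ_T + ∫ (∂_{p_{b₁}} u)² dμ_T) = ∫ u k dμ_T` with
`μ_T = e^{-H/T} dq dp` the unnormalised Gibbs weight. [folklore] -/
theorem tap_energy_identity (hω : 0 < ω₂) (hl : 0 ≤ lam) (hβ : 0 ≤ β) (hγ : 0 < γ) (hT : 0 < T)
    {u k : PhaseSpace N → ℝ} (hu : ContDiff ℝ 2 u)
    (hu2 : MemLp u 2 ((pinnedChain ω₂ lam β γ).gibbsMeasure N T)) (hkc : Continuous k)
    (hk2 : MemLp k 2 ((pinnedChain ω₂ lam β γ).gibbsMeasure N T))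
    (hpde : ∀ x, (pinnedChain ω₂ lam β γ).generator N T T u x = -k x)
    {b₀ b₁ : Fin N} (hb₀ : b₀.val = 0) (hb₁ : b₁.val = N - 1) :
    γ * T * ((∫ x, partialP b₀ u x ^ 2 ∂((volume : Measure (PhaseSpace N)).withDensity
        (fun x => ENNReal.ofReal (Real.exp (-((pinnedChain ω₂ lam β γ).hamiltonian N x) / T))))) +
      ∫ x, partialP b₁ u x ^ 2 ∂((volume : Measure (PhaseSpace N)).withDensity
        (fun x => ENNReal.ofReal (Real.exp (-((pinnedChain ω₂ lam β γ).hamiltonian N x) / T))))) =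
      ∫ x, u x * k x ∂((volume : Measure (PhaseSpace N)).withDensity
        (fun x => ENNReal.ofReal (Real.exp (-((pinnedChain ω₂ lam β γ).hamiltonian N x) / T)))) := by
  have hU : Continuous (pinnedChain ω₂ lam β γ).U := (pinnedChain_contDiff_U ω₂ lam β γ (n := 0)).continuous
  have hV : Continuous (pinnedChain ω₂ lam β γ).V := (pinnedChain_contDiff_V ω₂ lam β γ (n := 0)).continuous
  simp only [integral_withDensity_gibbs _ hU hV]
  rw [integral_mul_source_eq_dirichlet hω hl hβ hγ hT hu hu2 hkc hk2 hpde,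
    sum_bathWeight_mul (fun i => ∫ x, partialP i u x ^ 2 * (pinnedChain ω₂ lam β γ).gibbsDensity N T x) hb₀ hb₁]

end Pinned

end Summit.AtomisticToContinuum.FouriersLaw.Theorems.OddSectorIrreversibility.Corrector

end
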